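import Literature.MathematicalPhysics.QuantumFieldTheory.Balaban1983to89.B9

/-!
# `Balaban1983to89.B9SectBStepFamilyTransfer` — the Sect.-B step `B9.SectBStepPrinted` TRANSFERS between two readings of the same operators whose
# Theorem-3.1∕3.3 blocks dominate each other with changed constants («of course with different constants», p. 403)

T. Bałaban, *Propagators for lattice gauge theories in a background field*, Commun. Math. Phys. **99** (1985) 389–434
[`Balaban1985BackgroundPropagators`, "B9"], Theorem 3.4 p. 400, Sect. B pp. 400–407.

statement-level skeleton of published theorems with citation tags; proofs where landed; nothing here is a claim about the
Yang–Mills mass gap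

THE PRINTED LOCUS.  p. 403 l. 1–9: *"applying Theorem 3.1 for G′(U), the bound (3.63), the representation (3.64) and Lemma 2.1 of [4] we can prove
all the statements (3.42)–(3.47) of Theorem 3.1 for the operator G′(U′U), of course with different constants"*.  `B9.SectBStepPrinted` is stated for
ALL input constants with EXISTENTIAL output constants; hence it is insensitive to replacing the families `Gp`, `GA` by families whose Theorem-3.1∕3.3
blocks are equivalent to theirs UP TO CONSTANTS — at the (3.35)-regular inputs in one direction, at the products `U′U` in the other.

WHY THIS FILE (pub-ymgap N06 row 13, seat dag-n06-c gen 7).  The Sect.-B frames are instantiated at AUGMENTED coded readings (`B9SectBGpReadingsY.KSC`: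
both covariant differences on both sides of G′, letters at the base of a product) for which the frames' dictionaries are theorems; the record's
families are NODE 00's `kernelFamilyS`∕`kernelFamilyB` pulled back to the coded carrier.  This file is the generic bridge: ★ `sectBStepPrinted_of_family`.

WHAT IS IN THE FILE (0 sorry; no `def`): `sectBStepPrinted_of_family` — from `SectBStepPrinted d c35 geo bg Gp₁ GA₁ Cinv IsAn₁`, an INPUT domination
`hin` (at every (3.35)-regular `U`: the blocks of `(Gp₂, GA₂)` with given constants — of any sign — imply those of `(Gp₁, GA₁)` with some constants, uniformly), an
OUTPUT domination `hout` (at every product `U′U` over a regular `U` with `U′` in (3.37) at `α₁` below a cap: the blocks of `(Gp₁, GA₁)` imply those of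
`(Gp₂, GA₂)`, uniformly, the cap and the new constants depending on the old ones and on the available `α₁`-threshold) and an analyticity implication
`hAn`, conclude `SectBStepPrinted d c35 geo bg Gp₂ GA₂ Cinv IsAn₂`.

HONEST SCOPE.  Quantifier bookkeeping; nothing of [B9] asserted; COUNT-NEUTRAL; N06 NOT discharged; one finite lattice programme — nothing continuum ∕ OS ∕
mass-gap ∕ Clay.  Cell `pub-ymgap` (HUMAN RULING D-0062), Track A node N06 [B9], N06-ASSIGNMENT row 13, 2026-08-27.
-/

namespace Literature.MathematicalPhysics.QuantumFieldTheory.Balaban1983to89.B9SectBStepFamilyTransfer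

open Literature.MathematicalPhysics.QuantumFieldTheory.Balaban1983to89.B9 (Backgrounds Geometry KernelFamily SiteKernel Thms31to33IneqAt SectBStepPrinted)

variable {I : Type} (d : ℕ) (c35 : ℝ) (geo : I → Geometry) (bg : I → Backgrounds)
  (Gp₁ Gp₂ GA₁ GA₂ : ∀ i, KernelFamily (geo i) (bg i)) (Cinv : ∀ i, SiteKernel (geo i) (bg i))
  (IsAn₁ IsAn₂ : ∀ i, KernelFamily (geo i) (bg i) → (bg i).Cfg → ℝ → Prop)

/-- ★ **THE SECT.-B STEP TRANSFERS BETWEEN MUTUALLY DOMINATING READINGS** («of course with different constants», p. 403).  Inputs: at every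
(3.35)-regular `U` (above an `M`-threshold `Mi`, `Mα₀ ≦ ai`) the Theorem-3.1∕3.3 blocks of `(Gp₂, GA₂, Cinv)` with constants `t` (of any sign) give those of
`(Gp₁, GA₁, Cinv)` with constants `t′(t)`.  Outputs: for every constant tuple `t′` and cap `a > 0` there are a cap `0 < a′ ≦ a`, a threshold and
constants `t″` such that at every product `U′U` (`U` regular above the threshold, `U′` in (3.37) at `0 < α₁ ≦ a′`) the blocks of `(Gp₁, GA₁, Cinv)` with `t′`
give those of `(Gp₂, GA₂, Cinv)` with `t″`.  Analyticity: `IsAn₁ (Gp₁) ⇒ IsAn₂ (Gp₂)`, `IsAn₁ (GA₁) ⇒ IsAn₂ (GA₂)`.  Then the step for the first reading gives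
the step for the second. [cite: Balaban1985BackgroundPropagators, Thm 3.4 p.400, p.403 l.1–9, (3.35)–(3.37) p.396] -/
theorem sectBStepPrinted_of_family
    (hin : ∀ (B₀ δ₀ : ℝ) (Bβ Bε : ℝ → ℝ) (Bεβ : ℝ → ℝ → ℝ) (B₁ δ₁ : ℝ),
      ∃ (Mi ai B₀' δ₀' : ℝ) (Bβ' Bε' : ℝ → ℝ) (Bεβ' : ℝ → ℝ → ℝ) (B₁' δ₁' : ℝ), 0 < ai ∧
        ∀ i : I, Mi ≤ (geo i).M → ∀ α₀ : ℝ, 0 < α₀ → (geo i).M * α₀ ≤ ai → ∀ U : (bg i).Cfg, (bg i).Reg335 c35 α₀ U →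
          Thms31to33IneqAt d (Gp₂ i) (GA₂ i) (Cinv i) B₀ δ₀ Bβ Bε Bεβ B₁ δ₁ U →
          Thms31to33IneqAt d (Gp₁ i) (GA₁ i) (Cinv i) B₀' δ₀' Bβ' Bε' Bεβ' B₁' δ₁' U)
    (hout : ∀ (B₀ δ₀ : ℝ) (Bβ Bε : ℝ → ℝ) (Bεβ : ℝ → ℝ → ℝ) (B₁ δ₁ : ℝ) (a : ℝ), 0 < B₀ → 0 < δ₀ → 0 < B₁ → 0 < δ₁ → 0 < a →
      ∃ (Mo ao a' B₀' δ₀' : ℝ) (Bβ' Bε' : ℝ → ℝ) (Bεβ' : ℝ → ℝ → ℝ) (B₁' δ₁' : ℝ), 0 < ao ∧ 0 < a' ∧ a' ≤ a ∧ 0 < B₀' ∧ 0 < δ₀' ∧ 0 < B₁' ∧ 0 < δ₁' ∧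
        ∀ i : I, Mo ≤ (geo i).M → ∀ α₀ : ℝ, 0 < α₀ → (geo i).M * α₀ ≤ ao → ∀ U : (bg i).Cfg, (bg i).Reg335 c35 α₀ U →
          ∀ α₁ : ℝ, 0 < α₁ → α₁ ≤ a' → ∀ U' : (bg i).Cfg, (bg i).Cplx337 α₁ U U' →
          Thms31to33IneqAt d (Gp₁ i) (GA₁ i) (Cinv i) B₀ δ₀ Bβ Bε Bεβ B₁ δ₁ ((bg i).mul U' U) →
          Thms31to33IneqAt d (Gp₂ i) (GA₂ i) (Cinv i) B₀' δ₀' Bβ' Bε' Bεβ' B₁' δ₁' ((bg i).mul U' U))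
    (hAn : ∀ i (U : (bg i).Cfg) (α : ℝ), (IsAn₁ i (Gp₁ i) U α → IsAn₂ i (Gp₂ i) U α) ∧ (IsAn₁ i (GA₁ i) U α → IsAn₂ i (GA₂ i) U α))
    (h : SectBStepPrinted d c35 geo bg Gp₁ GA₁ Cinv IsAn₁) :
    SectBStepPrinted d c35 geo bg Gp₂ GA₂ Cinv IsAn₂ := by
  intro B₀ δ₀ Bβ Bε Bεβ B₁ δ₁
  obtain ⟨Mi, ai, B₀i, δ₀i, Bβi, Bεi, Bεβi, B₁i, δ₁i, hai, Hin⟩ := hin B₀ δ₀ Bβ Bε Bεβ B₁ δ₁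
  obtain ⟨M₀, a₁, a₀', B₀', δ₀', Bβ', Bε', Bεβ', B₁', δ₁', hM₀, ha₁, ha₀', hB₀', hδ₀', hB₁', hδ₁', H⟩ := h B₀i δ₀i Bβi Bεi Bεβi B₁i δ₁i
  obtain ⟨Mo, ao, a', B₀o, δ₀o, Bβo, Bεo, Bεβo, B₁o, δ₁o, hao, ha', ha'a, hB₀o, hδ₀o, hB₁o, hδ₁o, Hout⟩ :=
    hout B₀' δ₀' Bβ' Bε' Bεβ' B₁' δ₁' a₁ hB₀' hδ₀' hB₁' hδ₁' ha₁
  refine ⟨max M₀ (max Mi Mo), a', min a₀' (min ai ao), B₀o, δ₀o, Bβo, Bεo, Bεβo, B₁o, δ₁o,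
    lt_max_of_lt_left hM₀, ha', lt_min ha₀' (lt_min hai hao), hB₀o, hδ₀o, hB₁o, hδ₁o, fun i hM α₀ hα₀ hMa U hU hT α₁ hα₁ hα₁a => ?_⟩
  have hM0 : M₀ ≤ (geo i).M := le_trans (le_max_left _ _) hM
  have hMi : Mi ≤ (geo i).M := le_trans (le_trans (le_max_left _ _) (le_max_right _ _)) hM
  have hMo : Mo ≤ (geo i).M := le_trans (le_trans (le_max_right _ _) (le_max_right _ _)) hM
  have ha0 : (geo i).M * α₀ ≤ a₀' := le_trans hMa (min_le_left _ _)
  have hai' : (geo i).M * α₀ ≤ ai := le_trans hMa (le_trans (min_le_right _ _) (min_le_left _ _))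
  have hao' : (geo i).M * α₀ ≤ ao := le_trans hMa (le_trans (min_le_right _ _) (min_le_right _ _))
  have hT₁ := Hin i hMi α₀ hα₀ hai' U hU hT
  obtain ⟨hAp, hAA, Hprod⟩ := H i hM0 α₀ hα₀ ha0 U hU hT₁ α₁ hα₁ (le_trans hα₁a ha'a)
  refine ⟨(hAn i U α₁).1 hAp, (hAn i U α₁).2 hAA, fun U' hU' => ?_⟩
  exact Hout i hMo α₀ hα₀ hao' U hU α₁ hα₁ hα₁a U' hU' (Hprod U' hU')

end Literature.MathematicalPhysics.QuantumFieldTheory.Balaban1983to89.B9SectBStepFamilyTransfer
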